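import Summits.AnomalousDissipation.AnomalousDissipation.Theses.ImpulseGrid

/-!
# Crux `ImpulseGrid.BoundedEnergyNoLeakGrid` (stmt-AnomalousDissipation-14350) — round-2 ideator 5 sketch

NOT a line skeleton and NOT an idea card's first lemma: this file certifies, for the TENURE PLANNER of
route ImpulseGrid, that the QUANTIFIER-FLIPPED split of the target `GridThesis` composes (pure logic,
sorry-free), as an alternative to lead c4's resplits (A)/(B)/(C):

  current (rev 5):  BoundedEnergyNoLeakGrid (∀ design ∃ family)  →  GridSignsLaw (∃ design ∀ family)  →  GridThesis
  flipped  (D):     ExistsBoundedNoLeakIn good (∃ design ∈ 𝒟 ∃ family)  →  SignLawOn good (∀ design ∈ 𝒟 ∀ family)  →  GridThesis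

for an ARBITRARY design class `good` (a predicate on `(Φ, Ψ, G, c)` the planner instantiates with the
route's intended regime: cellular `G` at transverse wavenumber `m ≥ m₀`, thin unit-mass slab, Taylor
window `M c² ≲ |G| ≪ c²`).  Why: seven line leads certified that the ∀-design existence child is
EXACTLY "turbulent saturation for every columnar force" (UEDF necessary, p110786; ⇒ stmt-14641/14640,
p118293), a universal statement no mechanism can reach; the flip puts the open-problem-grade burden in
∃∃ form (ONE saturation instance anywhere in 𝒟 — dischargeable by any future saturation construction
that is flexible in the force, and the natural companion of Correlation's ∃-force items) and moves the
∀ onto the sign law, which IS the route's physical bet ("every fine grid wake relaxes monotonically").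
The law may additionally assume the no-leak clause of the family (it only weakens the law).

`lean check`: rc 0, 0 sorries expected.  Nothing about Navier–Stokes is used.
-/

set_option linter.dupNamespace false

namespace Summit.AnomalousDissipation.AnomalousDissipation.Cruxes.BoundedEnergyNoLeakGrid.Ideator5

open MeasureTheory Filter Set
open Literature.Analysis.FunctionSpaces Literature.Analysis.FunctionSpaces.Torus
open Literature.Analysis.FluidPDE Literature.Analysis.FluidPDE.Torus
open Summit.AnomalousDissipation.AnomalousDissipation.Theses.ImpulseGrid

local notation "𝕋³" => UnitAddTorus (Fin 3)
local notation "E³" => EuclideanSpace ℝ (Fin 3)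

/-- A design class: any predicate on grid designs `(Φ, Ψ, G, c)`. -/
abbrev DesignClass : Type := (𝕋³ → ℝ) → (𝕋³ → ℝ) → (𝕋³ → E³) → ℝ → Prop

/-- **ExistsBoundedNoLeakIn good** (∃∃): SOME design of the class carries a vanishing-viscosity global
Leray–Hopf drift family with per-`j` caps, `ν`-uniformly bounded mean energy and no Leray–Hopf leakage
in the mean.  (The design clauses are those of `GridSignsLaw`; the family clauses those of
`BoundedEnergyNoLeakGrid`'s conclusion.) -/
def ExistsBoundedNoLeakIn (good : DesignClass) : Prop :=
  ∃ (Φ Ψ : 𝕋³ → ℝ) (G : 𝕋³ → E³) (c : ℝ), good Φ Ψ G c ∧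
    IsSmooth Φ ∧ IsSmooth Ψ ∧ IsSmooth G ∧
    (∀ (s : UnitAddCircle) x, Φ (x + Pi.single (1 : Fin 3) s) = Φ x ∧ Φ (x + Pi.single (2 : Fin 3) s) = Φ x) ∧
    (∫ x, Φ x = 1) ∧
    (∀ (s : UnitAddCircle) x, Ψ (x + Pi.single (1 : Fin 3) s) = Ψ x ∧ Ψ (x + Pi.single (2 : Fin 3) s) = Ψ x) ∧
    (∀ (s : UnitAddCircle) x, G (x + Pi.single (0 : Fin 3) s) = G x) ∧ (∀ x, G x 0 = 0) ∧ IsDivFree G ∧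
    (∀ x, Torus.partialDeriv 0 Ψ x = Φ x - 1) ∧ (∫ x, Φ x * Ψ x * ‖G x‖ ^ 2 = 0) ∧
    IsSmooth (fun x => Φ x • G x) ∧ IsDivFree (fun x => Φ x • G x) ∧ HasZeroMean (fun x => Φ x • G x) ∧
    0 < c ∧
    ∃ (ν : ℕ → ℝ) (u₀ : ℕ → 𝕋³ → E³) (u : ℕ → ℝ → 𝕋³ → E³),
      (∀ j, 0 < ν j) ∧ Tendsto ν atTop (nhds 0) ∧
      (∀ j, IsGlobalLerayHopf (ν j) (fun _ => fun x => Φ x • G x) (u₀ j) (u j)) ∧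
      (∀ j, ∃ C : ℝ, ∀ t : ℝ, 0 ≤ t → kineticEnergy (u j t) ≤ C) ∧
      (∀ j, ∫ x, u₀ j x = c • EuclideanSpace.single 0 1) ∧
      (∃ E : ℝ, ∀ j, meanEnergy (u j) ≤ E) ∧
      (∀ j, longTimeAvgSup (fun t => ∫ x, inner ℝ (Φ x • G x) (u j t x)) ≤ meanDissipation (ν j) (u j))

/-- **SignLawOn good** (∀∀): at EVERY design of the class, EVERY bounded-energy no-leak drift family
obeys the two grid sign conditions eventually, in one Banach mean.  (`GridSignsLaw` is the `∃`-design
version; here the law ranges over the class and may use the no-leak clause as a hypothesis.) -/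
def SignLawOn (good : DesignClass) : Prop :=
  ∀ (Φ Ψ : 𝕋³ → ℝ) (G : 𝕋³ → E³) (c : ℝ), good Φ Ψ G c →
    IsSmooth Φ → IsSmooth Ψ → IsSmooth G →
    (∀ (s : UnitAddCircle) x, Φ (x + Pi.single (1 : Fin 3) s) = Φ x ∧ Φ (x + Pi.single (2 : Fin 3) s) = Φ x) →
    (∫ x, Φ x = 1) →
    (∀ (s : UnitAddCircle) x, Ψ (x + Pi.single (1 : Fin 3) s) = Ψ x ∧ Ψ (x + Pi.single (2 : Fin 3) s) = Ψ x) →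
    (∀ (s : UnitAddCircle) x, G (x + Pi.single (0 : Fin 3) s) = G x) → (∀ x, G x 0 = 0) → IsDivFree G →
    (∀ x, Torus.partialDeriv 0 Ψ x = Φ x - 1) → (∫ x, Φ x * Ψ x * ‖G x‖ ^ 2 = 0) →
    IsSmooth (fun x => Φ x • G x) → IsDivFree (fun x => Φ x • G x) → HasZeroMean (fun x => Φ x • G x) →
    0 < c →
    ∀ (ν : ℕ → ℝ) (u₀ : ℕ → 𝕋³ → E³) (u : ℕ → ℝ → 𝕋³ → E³) (E : ℝ),
      (∀ j, 0 < ν j) → Tendsto ν atTop (nhds 0) →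
      (∀ j, IsGlobalLerayHopf (ν j) (fun _ => fun x => Φ x • G x) (u₀ j) (u j)) →
      (∀ j, ∃ C : ℝ, ∀ t : ℝ, 0 ≤ t → kineticEnergy (u j t) ≤ C) →
      (∀ j, ∫ x, u₀ j x = c • EuclideanSpace.single 0 1) →
      (∀ j, meanEnergy (u j) ≤ E) →
      (∀ j, longTimeAvgSup (fun t => ∫ x, inner ℝ (Φ x • G x) (u j t x)) ≤ meanDissipation (ν j) (u j)) →
      ∃ η : ℝ, 0 < η ∧ ∃ (Λ : GeneralizedLimit) (J : ℕ), ∀ j, J ≤ j →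
        0 ≤ Λ.longTimeAvg (fun t => ∫ x, inner ℝ (G x) (u j t x)) ∧
        Λ.longTimeAvg (fun t => ∫ x, inner ℝ (u j t x - c • EuclideanSpace.single 0 1)
          (Torus.convect (fun y => u j t y - c • EuclideanSpace.single 0 1) (fun y => Ψ y • G y) x)) ≤ -η

/-- **The flipped glue** (D): `ExistsBoundedNoLeakIn good → SignLawOn good → GridThesis`, for every
design class `good`.  Same proof shape as the landed `Theorems.gridThesisGlue_proof` (stmt-14351):
take design AND family from the ∃∃ item, `(η, Λ, J)` from the law, reindex `j ↦ j + J`. -/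
theorem gridThesis_of_flip (good : DesignClass) :
    ExistsBoundedNoLeakIn good → SignLawOn good → GridThesis := by
  intro hEx hLaw
  obtain ⟨Φ, Ψ, G, c, hgood, hΦ, hΨ, hG, hΦper, hΦmass, hΨper, hGper, hG0, hGdiv, hΨderiv, hΦΨG,
    hfs, hfdiv, hfmean, hc, ν, u₀, u, hνpos, hν0, hLH, hsupE, hdrift, ⟨E, hE⟩, hnoleak⟩ := hEx
  obtain ⟨η, hη, Λ, J, hJ⟩ := hLaw Φ Ψ G c hgood hΦ hΨ hG hΦper hΦmass hΨper hGper hG0 hGdiv hΨderiv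
    hΦΨG hfs hfdiv hfmean hc ν u₀ u E hνpos hν0 hLH hsupE hdrift hE hnoleak
  refine ⟨Φ, Ψ, G, c, η, Λ, hΦ, hΨ, hG, hΨper, hGper, hG0, hGdiv, hΨderiv, hΦΨG, hfs, hfdiv,
    hfmean, hc, hη, fun j => ν (j + J), fun j => u₀ (j + J), fun j => u (j + J),
    fun j => hνpos _, hν0.comp (Filter.tendsto_add_atTop_nat J), fun j => hLH _,
    fun j => hsupE _, fun j => hdrift _, ⟨E, fun j => hE _⟩, fun j => hnoleak _,
    fun j => (hJ (j + J) (Nat.le_add_left J j)).1,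
    fun j => (hJ (j + J) (Nat.le_add_left J j)).2⟩

/-- Sanity link 1: the CURRENT children give the flipped ∃∃ item for the class "designs witnessing
`GridSignsLaw`-type clauses" — more simply, for the TRIVIAL class `⊤` the current existence crux plus
any admissible design give `ExistsBoundedNoLeakIn ⊤`.  Recorded as the statement that the flip's ∃∃
child is WEAKER than `BoundedEnergyNoLeakGrid` as soon as one admissible design with the two extra
`Ψ`-clauses exists (supplied here as a hypothesis `hD`, since exhibiting a smooth sawtooth is torus
calculus, not logic). -/
theorem existsBoundedNoLeakIn_top_of_boundedEnergyNoLeakGrid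
    (hD : ∃ (Φ Ψ : 𝕋³ → ℝ) (G : 𝕋³ → E³) (c : ℝ),
      IsSmooth Φ ∧ IsSmooth Ψ ∧ IsSmooth G ∧
      (∀ (s : UnitAddCircle) x, Φ (x + Pi.single (1 : Fin 3) s) = Φ x ∧ Φ (x + Pi.single (2 : Fin 3) s) = Φ x) ∧
      (∫ x, Φ x = 1) ∧
      (∀ (s : UnitAddCircle) x, Ψ (x + Pi.single (1 : Fin 3) s) = Ψ x ∧ Ψ (x + Pi.single (2 : Fin 3) s) = Ψ x) ∧
      (∀ (s : UnitAddCircle) x, G (x + Pi.single (0 : Fin 3) s) = G x) ∧ (∀ x, G x 0 = 0) ∧ IsDivFree G ∧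
      (∀ x, Torus.partialDeriv 0 Ψ x = Φ x - 1) ∧ (∫ x, Φ x * Ψ x * ‖G x‖ ^ 2 = 0) ∧
      IsSmooth (fun x => Φ x • G x) ∧ IsDivFree (fun x => Φ x • G x) ∧ HasZeroMean (fun x => Φ x • G x) ∧
      0 < c)
    (h : BoundedEnergyNoLeakGrid) :
    ExistsBoundedNoLeakIn (fun _ _ _ _ => True) := by
  obtain ⟨Φ, Ψ, G, c, hΦ, hΨ, hG, hΦper, hΦmass, hΨper, hGper, hG0, hGdiv, hΨderiv, hΦΨG, hfs, hfdiv,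
    hfmean, hc⟩ := hD
  obtain ⟨ν, u₀, u, hνpos, hν0, hLH, hsupE, hdrift, hE, hnoleak⟩ :=
    h Φ G c hΦ hG hΦper hΦmass hGper hG0 hfs hfdiv hfmean hc
  exact ⟨Φ, Ψ, G, c, trivial, hΦ, hΨ, hG, hΦper, hΦmass, hΨper, hGper, hG0, hGdiv, hΨderiv, hΦΨG, hfs,
    hfdiv, hfmean, hc, ν, u₀, u, hνpos, hν0, hLH, hsupE, hdrift, hE, hnoleak⟩

/-- Sanity link 2: the flipped law over the trivial class `⊤` IMPLIES the current `GridSignsLaw` at any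
admissible design (again supplied as `hD`): ∀∀ is stronger than ∃∀. -/
theorem gridSignsLaw_of_signLawOn_top
    (hD : ∃ (Φ Ψ : 𝕋³ → ℝ) (G : 𝕋³ → E³) (c : ℝ),
      IsSmooth Φ ∧ IsSmooth Ψ ∧ IsSmooth G ∧
      (∀ (s : UnitAddCircle) x, Φ (x + Pi.single (1 : Fin 3) s) = Φ x ∧ Φ (x + Pi.single (2 : Fin 3) s) = Φ x) ∧
      (∫ x, Φ x = 1) ∧
      (∀ (s : UnitAddCircle) x, Ψ (x + Pi.single (1 : Fin 3) s) = Ψ x ∧ Ψ (x + Pi.single (2 : Fin 3) s) = Ψ x) ∧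
      (∀ (s : UnitAddCircle) x, G (x + Pi.single (0 : Fin 3) s) = G x) ∧ (∀ x, G x 0 = 0) ∧ IsDivFree G ∧
      (∀ x, Torus.partialDeriv 0 Ψ x = Φ x - 1) ∧ (∫ x, Φ x * Ψ x * ‖G x‖ ^ 2 = 0) ∧
      IsSmooth (fun x => Φ x • G x) ∧ IsDivFree (fun x => Φ x • G x) ∧ HasZeroMean (fun x => Φ x • G x) ∧
      0 < c)
    (hNL : ∀ (ν : ℝ) (f : 𝕋³ → E³) (u₀ : 𝕋³ → E³) (u : ℝ → 𝕋³ → E³),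
      0 < ν → IsSmooth f → IsDivFree f → HasZeroMean f → IsGlobalLerayHopf ν (fun _ => f) u₀ u →
      (∃ C : ℝ, ∀ t : ℝ, 0 ≤ t → kineticEnergy (u t) ≤ C) →
      longTimeAvgSup (fun t => ∫ x, inner ℝ (f x) (u t x)) ≤ meanDissipation ν u)
    (h : SignLawOn (fun _ _ _ _ => True)) : GridSignsLaw := by
  obtain ⟨Φ, Ψ, G, c, hΦ, hΨ, hG, hΦper, hΦmass, hΨper, hGper, hG0, hGdiv, hΨderiv, hΦΨG, hfs, hfdiv,
    hfmean, hc⟩ := hD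
  refine ⟨Φ, Ψ, G, c, hΦ, hΨ, hG, hΦper, hΦmass, hΨper, hGper, hG0, hGdiv, hΨderiv, hΦΨG, hfs, hfdiv,
    hfmean, hc, ?_⟩
  intro ν u₀ u E hνpos hν0 hLH hsupE hdrift hE
  exact h Φ Ψ G c trivial hΦ hΨ hG hΦper hΦmass hΨper hGper hG0 hGdiv hΨderiv hΦΨG hfs hfdiv hfmean hc
    ν u₀ u E hνpos hν0 hLH hsupE hdrift hE
    (fun j => hNL (ν j) _ (u₀ j) (u j) (hνpos j) hfs hfdiv hfmean (hLH j) (hsupE j))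

end Summit.AnomalousDissipation.AnomalousDissipation.Cruxes.BoundedEnergyNoLeakGrid.Ideator5
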